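import Summits.KontsevichZagierPeriods.KontsevichZagierPeriods.Theorems.RootDecompQuadraticDescentPair18HomotopyP20

/-! # `RootDecompQuadraticDescentPair18HomotopyP21` — part 21/31 of the mechanical ≤400-line split of `Pair18Homotopy_v14_noguard.lean` (sha256 72e9c8442b4af820…)
Source: decomp-kz lens-6 g9 `Pair18Homotopy.lean` v14 (HOME/decomp-kz-lens-6/g9/, sha256 3dda3232…; critic g4-48/g4-53/g4-56/g5 CLEARED; census pair #18 of crux stmt-KontsevichZagierPeriods-28994: homotopy cells, duplications, inversions, Euler–Landen, arc/angle regions; terminal `pair18_g8strips_of_grid : hEuler → hGrid → hAng4 → (g8 form of #18)`); `#guard_msgs … #print axioms` pins removed for landing.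
Split by census-1 g9 `gen/splitlean.py`: scopes re-opened with their `open`/`variable`/`set_option` context; mathematics and declaration order unchanged. -/

set_option linter.unusedSimpArgs false
noncomputable section
open _root_.Set MvPolynomial
namespace Summit.KontsevichZagierPeriods.RootDecompQuadraticDescent.Pair18Homotopy
open Literature.NumberTheory.Transcendental
open Literature.NumberTheory.Transcendental.KZ (RFun cube)
open Summit.KontsevichZagierPeriods.RootDecompQuadraticDescent.DarkPairs (rel_reflect_rep rel_double)

section Pencil2
open Literature.ModelTheory.ExponentialFields (IsSemialgebraic isSemialgebraic_setOf_eval_le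
  isSemialgebraic_setOf_eval_pos isSemialgebraic_setOf_eval_nonneg isSemialgebraic_setOf_eval_eq_zero)

open _root_.Set MvPolynomial in
open Literature.NumberTheory.Transcendental in
open Literature.NumberTheory.Transcendental.KZ (RFun cube) in
open Summit.KontsevichZagierPeriods.RootDecompQuadraticDescent.DarkPairs (rel_reflect_rep rel_double) in
/-- Auxiliary step `vec2_1` (§2b): vec2 1. [bookkeeping] -/
private theorem vec2_1 (a b : ℝ) : (![a, b] : Fin 2 → ℝ) 1 = b := rfl

open _root_.Set MvPolynomial in
open Literature.NumberTheory.Transcendental in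
open Literature.NumberTheory.Transcendental.KZ (RFun cube) in
open Summit.KontsevichZagierPeriods.RootDecompQuadraticDescent.DarkPairs (rel_reflect_rep rel_double) in
/-- Auxiliary step `vec2_0` (§2b): vec2 0. [bookkeeping] -/
private theorem vec2_0 (a b : ℝ) : (![a, b] : Fin 2 → ℝ) 0 = a := rfl

open _root_.Set MvPolynomial in
open Literature.NumberTheory.Transcendental in
open Literature.NumberTheory.Transcendental.KZ (RFun cube) in
open Summit.KontsevichZagierPeriods.RootDecompQuadraticDescent.DarkPairs (rel_reflect_rep rel_double) in
/-- Auxiliary step `cube2` (§0): cube2. [bookkeeping] -/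
private theorem cube2 {x : Fin 2 → ℝ} (hx : x ∈ KZ.cube 2) : (0 ≤ x 0 ∧ x 0 ≤ 1) ∧ (0 ≤ x 1 ∧ x 1 ≤ 1) := ⟨hx 0, hx 1⟩

/-- **`[Gp | 7W² ≥ (8−t²)(1−x)²] ≡ [PB7]`** by the algebraic map `(x,t) ↦ (t/s(t), (1−x)s(t)/W)`. -/
theorem Gp2_PB7 : KZ.of Gp2 - KZ.of PB7.rep ∈ KZ.relations := by
  let Φ : (Fin 2 → ℝ) → (Fin 2 → ℝ) := fun z =>
    ![z 1 / sR (z 1), (1 - z 0) * sR (z 1) / (4 * z 0 + z 1 * (1 - z 0))]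
  let M01 : (Fin 2 → ℝ) → ℝ := fun z => 8 / (7 * sR (z 1) ^ 3)
  let M10 : (Fin 2 → ℝ) → ℝ := fun z => -(4 * sR (z 1)) / (4 * z 0 + z 1 * (1 - z 0)) ^ 2
  let M11 : (Fin 2 → ℝ) → ℝ := fun z =>
    (1 - z 0) * (-(z 1) / (7 * sR (z 1)) * (4 * z 0 + z 1 * (1 - z 0)) - sR (z 1) * (1 - z 0)) /
      (4 * z 0 + z 1 * (1 - z 0)) ^ 2
  let Mz : (Fin 2 → ℝ) → Matrix (Fin 2) (Fin 2) ℝ := fun z => !![0, M01 z; M10 z, M11 z]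
  let Φ' : (Fin 2 → ℝ) → (Fin 2 → ℝ) →L[ℝ] (Fin 2 → ℝ) := fun z =>
    LinearMap.toContinuousLinearMap (Matrix.toLin' (Mz z))
  have hΦ'ap : ∀ z w, Φ' z w = ![M01 z * w 1, M10 z * w 0 + M11 z * w 1] := by
    intro z w; funext i
    fin_cases i <;> simp [Φ', Mz, Matrix.toLin'_apply, Matrix.mulVec, dotProduct, Fin.sum_univ_two]
  have hdet : ∀ z, (Φ' z).det = -(M01 z * M10 z) := by
    intro z
    unfold ContinuousLinearMap.det
    simp [Φ', LinearMap.det_toLin', Mz, Matrix.det_fin_two]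
  have hΦ0 : ∀ z, Φ z 0 = z 1 / sR (z 1) := fun z => rfl
  have hΦ1 : ∀ z, Φ z 1 = (1 - z 0) * sR (z 1) / (4 * z 0 + z 1 * (1 - z 0)) := fun z => rfl
  have hdom : PB7.rep.domain = Φ '' Gp2.domain := by
    simp only [Gp2, KZ.IntegralRep.domain_restrict, RFun.rep_domain]
    ext w
    constructor
    · intro hw
      have hw0 := (hw 0).1
      have hw0' := (hw 0).2
      have hw1 := (hw 1).1
      have hw1' := (hw 1).2
      obtain ⟨t, ht, ht_eq⟩ : ∃ t ∈ Icc (0:ℝ) 1, 7 * t * t - w 0 * w 0 * (8 - t * t) = 0 := by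
        have hc : ContinuousOn (fun t : ℝ => 7 * t * t - w 0 * w 0 * (8 - t * t)) (Icc 0 1) := by fun_prop
        have hmem : (0:ℝ) ∈ Icc ((fun t : ℝ => 7 * t * t - w 0 * w 0 * (8 - t * t)) 0)
            ((fun t : ℝ => 7 * t * t - w 0 * w 0 * (8 - t * t)) 1) := by
          constructor
          · simp only; nlinarith [mul_nonneg hw0 hw0]
          · simp only; nlinarith [mul_le_one₀ hw0' hw0 hw0']
        exact intermediate_value_Icc (by norm_num) hc hmem
      have t8 : t * t < 8 := by nlinarith [ht.1, ht.2]
      have hs := sR_pos t8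
      have hs2 := sR_sq t8.le
      have hs1 := one_le_sR (show t * t ≤ 1 by nlinarith [ht.1, ht.2])
      have hρ : t = w 0 * sR t := by
        have e : (w 0 * sR t) ^ 2 = t ^ 2 := by
          rw [mul_pow, hs2]; linear_combination (-1 / 7 : ℝ) * ht_eq
        exact ((pow_left_inj₀ (mul_nonneg hw0 hs.le) ht.1 two_ne_zero).mp e).symm
      obtain ⟨x, hx, hx_eq⟩ : ∃ x ∈ Icc (0:ℝ) 1, w 1 * (4 * x + t * (1 - x)) - (1 - x) * sR t = 0 := by
        have hc : ContinuousOn (fun x : ℝ => w 1 * (4 * x + t * (1 - x)) - (1 - x) * sR t) (Icc 0 1) := by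
          fun_prop
        have hmem : (0:ℝ) ∈ Icc ((fun x : ℝ => w 1 * (4 * x + t * (1 - x)) - (1 - x) * sR t) 0)
            ((fun x : ℝ => w 1 * (4 * x + t * (1 - x)) - (1 - x) * sR t) 1) := by
          constructor
          · simp only; nlinarith [mul_le_one₀ hw1' ht.1 ht.2]
          · simp only; nlinarith
        exact intermediate_value_Icc (by norm_num) hc hmem
      have hW : (0:ℝ) < 4 * x + t * (1 - x) := by
        have hW0 : (0:ℝ) ≤ 4 * x + t * (1 - x) := by nlinarith [mul_nonneg ht.1 (sub_nonneg.2 hx.2)]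
        rcases hW0.lt_or_eq with h | h
        · exact h
        · exfalso
          rw [← h, mul_zero, zero_sub, neg_eq_zero] at hx_eq
          rcases mul_eq_zero.mp hx_eq with h' | h'
          · have hx1 : x = 1 := by linarith
            rw [hx1] at h; norm_num at h
          · exact hs.ne' h'
      refine ⟨![x, t], ⟨?_, ?_⟩, ?_⟩
      · intro i
        fin_cases i
        · simpa using hx
        · simpa using ht
      · simp only [sP2, mem_setOf_eq, Matrix.cons_val_zero, Matrix.cons_val_one, Matrix.head_cons]
        have hle : (1 - x) * sR t ≤ 4 * x + t * (1 - x) := by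
          have : (1 - x) * sR t = w 1 * (4 * x + t * (1 - x)) := by linarith
          rw [this]; exact mul_le_of_le_one_left hW.le hw1'
        have hsq := mul_self_le_mul_self (mul_nonneg (sub_nonneg.2 hx.2) hs.le) hle
        have e : (1 - x) * sR t * ((1 - x) * sR t) = (8 - t * t) * ((1 - x) * (1 - x)) / 7 := by
          rw [show (1 - x) * sR t * ((1 - x) * sR t) = (1 - x) * (1 - x) * sR t ^ 2 by ring, hs2]; ring
        rw [e] at hsq
        nlinarith [hsq]
      · funext i
        fin_cases i
        · have key : t / sR t = w 0 := by rw [div_eq_iff hs.ne']; exact hρ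
          simpa [Φ] using key
        · have key : (1 - x) * sR t / (4 * x + t * (1 - x)) = w 1 := by
            rw [div_eq_iff hW.ne']; linarith
          simpa [Φ] using key
    · rintro ⟨z, hz, rfl⟩
      obtain ⟨h0, h1, hΔ, hW, hs, hs2, h2⟩ := P2_facts z hz
      have hs1 := one_le_sR (show z 1 * z 1 ≤ 1 by nlinarith)
      have c0 : 0 ≤ z 1 / sR (z 1) ∧ z 1 / sR (z 1) ≤ 1 :=
        ⟨div_nonneg h1.1 hs.le, (div_le_one hs).mpr (by linarith)⟩
      have c1 : 0 ≤ (1 - z 0) * sR (z 1) / (4 * z 0 + z 1 * (1 - z 0)) ∧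
          (1 - z 0) * sR (z 1) / (4 * z 0 + z 1 * (1 - z 0)) ≤ 1 := by
        refine ⟨div_nonneg (mul_nonneg (sub_nonneg.2 h0.2) hs.le) hW.le, ?_⟩
        rw [div_le_one hW]
        have hsq : ((1 - z 0) * sR (z 1)) ^ 2 ≤ (4 * z 0 + z 1 * (1 - z 0)) ^ 2 := by
          rw [mul_pow, hs2]; nlinarith [h2]
        exact (pow_le_pow_iff_left₀ (mul_nonneg (sub_nonneg.2 h0.2) hs.le) hW.le two_ne_zero).mp hsq
      intro i
      fin_cases i
      · exact c0
      · exact c1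
  refine KZ.changeOfVariablesRel_subset_relations ⟨2, Gp2, PB7.rep, Φ, Φ', ?_, ?_, ?_, hdom, ?_, rfl⟩
  · have hsd : IsSemialgebraic ℚ Gp2.domain := Gp2.isSemialgebraic_domain
    refine (isSemialgebraicMapOn_iff_forall_holds hsd).mpr fun i => ?_
    fin_cases i
    · refine (isSemialgebraicFunOn_of_sq hsd (fun z => z 1 / sR (z 1)) (C 7 * X 1 * X 1) (C 8 - X 1 * X 1)
        (fun z hz => ?_) (fun z hz => ?_) (fun z hz => ?_)).congr fun z _ => by simp [Φ]
      · obtain ⟨h0, h1, hΔ, -⟩ := P2_facts z hz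
        simp only [map_sub, map_mul, aeval_C, aeval_X, eq_ratCast, Rat.cast_ofNat]
        exact hΔ
      · obtain ⟨h0, h1, hΔ, hW, hs, -⟩ := P2_facts z hz
        exact div_nonneg h1.1 hs.le
      · obtain ⟨h0, h1, hΔ, hW, hs, hs2, -⟩ := P2_facts z hz
        simp only [map_sub, map_mul, aeval_C, aeval_X, eq_ratCast, Rat.cast_ofNat]
        rw [div_pow, hs2, div_div_eq_mul_div, div_mul_eq_mul_div, div_eq_iff hΔ.ne']
        ring
    · refine (isSemialgebraicFunOn_of_sq hsd (fun z => (1 - z 0) * sR (z 1) / (4 * z 0 + z 1 * (1 - z 0)))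
        CoR CoL (fun z hz => ?_) (fun z hz => ?_) (fun z hz => ?_)).congr fun z _ => by simp [Φ]
      · obtain ⟨h0, h1, hΔ, hW, -⟩ := P2_facts z hz
        rw [aeval_CoL]; positivity
      · obtain ⟨h0, h1, hΔ, hW, hs, -⟩ := P2_facts z hz
        exact div_nonneg (mul_nonneg (sub_nonneg.2 h0.2) hs.le) hW.le
      · obtain ⟨h0, h1, hΔ, hW, hs, hs2, -⟩ := P2_facts z hz
        rw [aeval_CoL, aeval_CoR, div_pow, mul_pow, hs2]
        generalize hWv : 4 * z 0 + z 1 * (1 - z 0) = W at *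
        field_simp
  · intro z hz
    obtain ⟨h0, h1, hΔ, hW, hs, hs2, h2⟩ := P2_facts z hz
    have t8 : z 1 * z 1 < 8 := by nlinarith
    have hcomp0 : HasFDerivAt (fun w : Fin 2 → ℝ => w 1 / sR (w 1))
        ((M01 z) • ContinuousLinearMap.proj (R := ℝ) (φ := fun _ : Fin 2 => ℝ) 1) z :=
      HasDerivAt.comp_hasFDerivAt (𝕜 := ℝ) (h₂ := fun v : ℝ => v / sR v)
        (f := fun w : Fin 2 → ℝ => w 1) z (hasDerivAt_rho t8) (hasFDerivAt_apply (𝕜 := ℝ) 1 z)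
    have hA : HasFDerivAt (fun w : Fin 2 → ℝ => 1 - w 0)
        (-(ContinuousLinearMap.proj (R := ℝ) (φ := fun _ : Fin 2 => ℝ) 0)) z :=
      (hasFDerivAt_apply (𝕜 := ℝ) 0 z).const_sub 1
    have hS : HasFDerivAt (fun w : Fin 2 → ℝ => sR (w 1))
        ((-(z 1) / (7 * sR (z 1))) • ContinuousLinearMap.proj (R := ℝ) (φ := fun _ : Fin 2 => ℝ) 1) z :=
      HasDerivAt.comp_hasFDerivAt (𝕜 := ℝ) (h₂ := sR) (f := fun w : Fin 2 → ℝ => w 1) z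
        (hasDerivAt_sR t8) (hasFDerivAt_apply (𝕜 := ℝ) 1 z)
    have hWd := ((hasFDerivAt_apply (𝕜 := ℝ) 0 z).const_mul (4:ℝ)).add
      ((hasFDerivAt_apply (𝕜 := ℝ) 1 z).mul hA)
    have hinv := (hasDerivAt_inv hW.ne').comp_hasFDerivAt z hWd
    have hcomp1 := (hA.mul hS).mul hinv
    have hpi : HasFDerivAt Φ (Φ' z) z := by
      rw [hasFDerivAt_pi']
      intro i
      fin_cases i
      · refine (hcomp0.congr_fderiv ?_).congr_of_eventuallyEq (Filter.Eventually.of_forall fun y => ?_)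
        · ext w; simp [hΦ'ap]
        · simp only [Fin.zero_eta, hΦ0, Function.comp_apply]
      · refine (hcomp1.congr_fderiv ?_).congr_of_eventuallyEq (Filter.Eventually.of_forall fun y => ?_)
        · ext w
          simp [hΦ'ap, M10, M11]
          field_simp
          ring
        · simp only [Fin.mk_one, hΦ1, Function.comp_apply, Pi.mul_apply, Pi.add_apply, div_eq_mul_inv]
    exact hpi.hasFDerivWithinAt
  · intro z₁ hz₁ z₂ hz₂ heq
    obtain ⟨a0, a1, aΔ, aW, as, as2, a2⟩ := P2_facts z₁ hz₁
    obtain ⟨b0, b1, bΔ, bW, bs, bs2, b2⟩ := P2_facts z₂ hz₂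
    have e0 : z₁ 1 / sR (z₁ 1) = z₂ 1 / sR (z₂ 1) := by simpa [Φ] using congrFun heq 0
    have e1 : (1 - z₁ 0) * sR (z₁ 1) / (4 * z₁ 0 + z₁ 1 * (1 - z₁ 0)) =
        (1 - z₂ 0) * sR (z₂ 1) / (4 * z₂ 0 + z₂ 1 * (1 - z₂ 0)) := by simpa [Φ] using congrFun heq 1
    have e0' := congrArg (fun r => r ^ 2) e0
    simp only [div_pow, as2, bs2] at e0'
    rw [div_eq_div_iff (div_pos aΔ (by norm_num)).ne' (div_pos bΔ (by norm_num)).ne'] at e0'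
    have f1 : (z₁ 1 - z₂ 1) * (z₁ 1 + z₂ 1) = 0 := by linear_combination (7 / 8 : ℝ) * e0'
    have s1 : z₁ 1 = z₂ 1 := by
      rcases mul_eq_zero.mp f1 with h | h
      · linarith
      · have : z₁ 1 = 0 := by linarith [a1.1, b1.1]
        have : z₂ 1 = 0 := by linarith [a1.1, b1.1]
        linarith
    rw [← s1] at e1
    rw [div_eq_div_iff aW.ne' (by rw [s1]; exact bW.ne')] at e1
    have f0 : sR (z₁ 1) * (4 * (z₂ 0 - z₁ 0)) = 0 := by linear_combination e1
    have s0 : z₁ 0 = z₂ 0 := by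
      rcases mul_eq_zero.mp f0 with h | h
      · exact absurd h as.ne'
      · linarith
    funext i
    fin_cases i
    · exact s0
    · exact s1
  · intro z hz
    obtain ⟨h0, h1, hΔ, hW, hs, hs2, h2⟩ := P2_facts z hz
    have hp := GpDen_pos (show z ∈ cube 2 from hz.1)
    simp only [GpDen, map_add, map_sub, map_mul, map_pow, map_neg, aeval_C, aeval_X, map_one, map_ofNat, eq_ratCast, Rat.cast_one, Rat.cast_ofNat, Rat.cast_div, Rat.cast_neg] at hp
    have hd : (Φ' z).det = 32 / ((8 - z 1 * z 1) * (4 * z 0 + z 1 * (1 - z 0)) ^ 2) := by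
      rw [hdet z]
      simp only [M01, M10]
      rw [show (32:ℝ) / ((8 - z 1 * z 1) * (4 * z 0 + z 1 * (1 - z 0)) ^ 2) =
          32 / (7 * sR (z 1) ^ 2 * (4 * z 0 + z 1 * (1 - z 0)) ^ 2) by rw [hs2]; ring]
      field_simp
      ring
    rw [hd, abs_of_pos (div_pos (by norm_num) (mul_pos hΔ (pow_pos hW 2)))]
    simp only [Gp2, KZ.IntegralRep.integrand_restrict, RFun.rep_integrand]
    simp only [Gp, PB7, PB7Den, GpDen, RFun.fn, Φ, map_add, map_sub, map_mul, map_pow, map_neg, aeval_C, aeval_X, map_one, map_ofNat, eq_ratCast, Rat.cast_one, Rat.cast_ofNat, Rat.cast_div, Rat.cast_neg, vec2_0, vec2_1, Matrix.cons_val_zero, Matrix.cons_val_one, Matrix.head_cons]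
    have hρ2 : z 1 / sR (z 1) * (z 1 / sR (z 1)) = 7 * (z 1 * z 1) / (8 - z 1 * z 1) := by
      rw [div_mul_div_comm, show sR (z 1) * sR (z 1) = sR (z 1) ^ 2 by ring, hs2]
      field_simp
    have hσ2 : (1 - z 0) * sR (z 1) / (4 * z 0 + z 1 * (1 - z 0)) * ((1 - z 0) * sR (z 1) / (4 * z 0 + z 1 * (1 - z 0))) =
        (8 - z 1 * z 1) * ((1 - z 0) * (1 - z 0)) / (7 * (4 * z 0 + z 1 * (1 - z 0)) ^ 2) := by
      rw [div_mul_div_comm, show (1 - z 0) * sR (z 1) * ((1 - z 0) * sR (z 1)) =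
        (1 - z 0) * (1 - z 0) * sR (z 1) ^ 2 by ring, hs2]
      field_simp
    generalize hρv : z 1 / sR (z 1) = ρ at *
    generalize hσv : (1 - z 0) * sR (z 1) / (4 * z 0 + z 1 * (1 - z 0)) = σ at *
    rw [show (7:ℝ) * σ * σ = 7 * (σ * σ) by ring, hσ2, hρ2]
    have hE1 : (0:ℝ) < 1 + 7 * ((8 - z 1 * z 1) * ((1 - z 0) * (1 - z 0)) / (7 * (4 * z 0 + z 1 * (1 - z 0)) ^ 2)) := by
      have := div_nonneg (mul_nonneg hΔ.le (mul_self_nonneg (1 - z 0)))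
        (show (0:ℝ) ≤ 7 * (4 * z 0 + z 1 * (1 - z 0)) ^ 2 by positivity)
      linarith
    have hE2 : (0:ℝ) < 7 + 7 * (z 1 * z 1) / (8 - z 1 * z 1) := by
      have := div_nonneg (mul_nonneg (by norm_num : (0:ℝ) ≤ 7) (mul_self_nonneg (z 1))) hΔ.le
      linarith
    generalize hWv : 4 * z 0 + z 1 * (1 - z 0) = W at *
    generalize hDv : 8 - z 1 * z 1 = Δ at *
    generalize hPv : (1 - z 0) * (1 - z 0) + z 1 * z 0 * (1 - z 0) + 2 * z 0 * z 0 = P at *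
    generalize hE1v : 1 + 7 * (Δ * ((1 - z 0) * (1 - z 0)) / (7 * W ^ 2)) = E1 at *
    generalize hE2v : 7 + 7 * (z 1 * z 1) / Δ = E2 at *
    have hW0 : W ≠ 0 := hW.ne'
    have hD0 : Δ ≠ 0 := hΔ.ne'
    have hP0 : P ≠ 0 := hp.ne'
    have hE10 : E1 ≠ 0 := hE1.ne'
    have hE20 : E2 ≠ 0 := hE2.ne'
    field_simp
    subst hE1v hE2v
    field_simp
    subst hWv hDv hPv
    ring

/-- Auxiliary step `P1t_facts`: P1t facts. [bookkeeping] -/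
theorem P1t_facts (z : Fin 2 → ℝ) (hz : z ∈ P1t) :
    (0 ≤ z 0 ∧ z 0 ≤ 1) ∧ (0 ≤ z 1 ∧ z 1 ≤ 1) ∧ 0 < 8 - z 1 * z 1 ∧ 0 < 1 - z 0 ∧ 0 < z 1 ∧
      0 < 4 * z 0 + z 1 * (1 - z 0) ∧
      7 * (4 * z 0 + z 1 * (1 - z 0)) * (4 * z 0 + z 1 * (1 - z 0)) ≤ (8 - z 1 * z 1) * ((1 - z 0) * (1 - z 0)) := by
  obtain ⟨⟨hzc, hP⟩, ht⟩ := hz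
  obtain ⟨h0, h1⟩ := cube2 hzc
  simp only [sP1, mem_setOf_eq] at hP ht
  have hΔ : (0:ℝ) < 8 - z 1 * z 1 := by nlinarith
  have hx1 : (0:ℝ) < 1 - z 0 := by
    rcases (sub_nonneg.2 h0.2).lt_or_eq with h | h
    · exact h
    · exfalso
      have hx : z 0 = 1 := by linarith
      rw [hx] at hP; norm_num at hP
  have hW : (0:ℝ) < 4 * z 0 + z 1 * (1 - z 0) := by nlinarith [mul_pos ht hx1]
  exact ⟨h0, h1, hΔ, hx1, ht, hW, hP⟩

end Pencil2
end Summit.KontsevichZagierPeriods.RootDecompQuadraticDescent.Pair18Homotopy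
end
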